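import Literature.NumberTheory.EllipticCurves.TateModuleOpenImageNonCMProofs
import Literature.NumberTheory.EllipticCurves.Kato2004.Condition1252QuadraticTwistProofs
import Literature.NumberTheory.EllipticCurves.TateModuleFinrankProofs
import Literature.NumberTheory.EllipticCurves.QuadraticTwistPadicReduction
import Literature.NumberTheory.EllipticCurves.GlobalMinimalModelProofs
import Literature.NumberTheory.EllipticCurves.ComplexMultiplicationHasCMProofs
import HarnessLib

/-!
# Kato 2004 (Astérisque 295), Thm. 13.4, hypothesis (v) for `T = T_pE` holds for EVERY non-CM
# elliptic curve `E/ℚ` at EVERY prime `p` (proofs file)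

Topic `NumberTheory/EllipticCurves`, sub-directory `Kato2004`.  Theorems only (no definition, no
named fact, no `sorry`).  Cell `bsd-potss` (HOME `run/shared/lean/pub/bsd-potss/`), seat
`bsd-potss-k8q-c2x` g5 (prover; lane B of the K8 Kato side).  HONEST FRAMING: BSD is not proved by
any of this; this file discharges an IMAGE HYPOTHESIS of a named Literature fact on the tree's
objects; the fact itself (Kato's Euler-system bound Thm. 13.4,
`Kato2004.thm13_4_lengthAt_fineSelmerDual_le_of_isEulerSystemClass`) stays cite-level.

Kato, Thm. 13.4 (p. 226), hypothesis (v): "There exists an element `σ` of `Gal(ℚ̄/ℚ(ζ_{p^∞}))`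
such that `dim_L(Coker(1 − σ ; T ⊗_{O_L} L → T ⊗_{O_L} L)) = 1`", and after the statement: "However
if `f` has CM, this theorem is not applied because the condition (v) is not satisfied in the CM
case."  The tree spells (v) for `T = T_pW` as the binder
`∃ σ, (∀ n t, t ^ p ^ n = 1 → σ • t = t) ∧ Module.finrank ℤ_[p] (T_pW ⧸ range(ρ(σ) − 1)) = 1`
of that named fact, and so far produces it ONLY from Kato's (12.5.2) (`Kato2004.ImageContainsSL2`,
tower-onto rows: `exists_finrank_coker_eq_one_of_imageContainsSL2`).  THIS FILE proves it for every
non-CM curve, from the `p`-adic open image theorem of the tree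
(`WeierstrassCurve.exists_congruenceSubgroup_le_of_not_hasCM`, Serre 1968 IV-11): the image of
`Γ_ℚ` contains `Γ(pˢ)`, in particular the unipotent `u = (1 pˢ; 0 1)`; a `σ` with `ρ(σ) = u` has
`det ρ(σ) = 1 = χ_p(σ)`, so fixes `μ_{p^∞}`, and `Coker(ρ(σ) − 1) = T/pˢℤ_p e₁ ≅ ℤ_p ⊕ ℤ/pˢ` has
`ℤ_p`-rank one (rank–nullity over the domain `ℤ_p`).

* `Kato2004.finrank_quotient_range_sub_one_eq_one` — linear algebra: `f` with matrix `(1 c; 0 1)`,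
  `c ≠ 0`, on a free rank-2 `ℤ_p`-module has `rank(T/(f − 1)T) = 1`;
* `Kato2004.exists_finrank_coker_eq_one_of_not_hasCM` — **(v) for every globally minimal non-CM
  `E/ℚ` and every `p`**;
* `Kato2004.exists_finrank_coker_eq_one_of_smul_eq_quadraticTwist_primeStar` — (v) transports from
  `V` to `W` along `C • W^{(p*)} = V` (`p` odd; every `σ ∈ Gal(ℚ̄/ℚ(ζ_{p^∞}))` fixes `√p* ∈ ℚ(ζ_p)`,
  `Kato2004.smul_geomSqrt_primeStar_eq`), and
  `Kato2004.exists_finrank_coker_eq_one_twist_of_not_hasCM` — (v) for the additive partner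
  `W` of a globally minimal non-CM `V` with `C • W^{(p*)} = V` (the shape consumed on rung K8 of
  `BirchSwinnertonDyer`, where `W = V ⊗ η` carries Kobayashi's `η`-projected zeta element).

References: [Kato2004Asterisque] Thm. 13.4 (v) and the remark after it (p. 226), (12.8.2) (p. 223);
[SerreAbelianLadic1968] Ch. IV §2.2 (IV-11).
-/

noncomputable section

open scoped MatrixGroups Classical
open Field WeierstrassCurve
open Literature.NumberTheory.GaloisRepresentations Literature.NumberTheory.EllipticCurves
open Literature.GroupTheory.Index

namespace Literature.NumberTheory.EllipticCurves.Kato2004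

variable {p : ℕ} [Fact p.Prime]

/-- **Linear algebra of a unipotent**: on a finite free `ℤ_p`-module `T` with a basis `b` indexed
by `Fin 2`, an endomorphism `f` with matrix `(1 c; 0 1)`, `c ≠ 0`, has
`rank_{ℤ_p}(T/(f − 1)T) = 1` — `(f − 1)T = ℤ_p · c b₀` is free of rank one and rank–nullity holds
over the domain `ℤ_p`.  (The computation behind "`dim_L Coker(1 − σ) = 1`" for a unipotent `σ`.)
[cite: Kato2004Asterisque, Thm. 13.4 (v) (p. 226)] -/
theorem finrank_quotient_range_sub_one_eq_one {T : Type} [AddCommGroup T] [Module ℤ_[p] T]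
    [Module.Free ℤ_[p] T] [Module.Finite ℤ_[p] T] (b : Module.Basis (Fin 2) ℤ_[p] T)
    (f : T →ₗ[ℤ_[p]] T) {c : ℤ_[p]} (hc : c ≠ 0)
    (hf : LinearMap.toMatrix b b f = !![1, c; 0, 1]) :
    Module.finrank ℤ_[p] (T ⧸ LinearMap.range (f - 1)) = 1 := by
  classical
  -- `f - 1 = (a ↦ (coord₁ a) • c b₀)`
  have hfb : ∀ i, f (b i) = ∑ j, (!![1, c; 0, 1] : Matrix (Fin 2) (Fin 2) ℤ_[p]) j i • b j := by
    intro i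
    have h := Matrix.toLin_self (v₁ := b) (v₂ := b) (LinearMap.toMatrix b b f) i
    rwa [Matrix.toLin_toMatrix, hf] at h
  have hf1 : f - 1 = (LinearMap.toSpanSingleton ℤ_[p] T (c • b 0)).comp (b.coord 1) := by
    refine b.ext fun i => ?_
    rw [LinearMap.sub_apply, Module.End.one_apply, LinearMap.comp_apply,
      LinearMap.toSpanSingleton_apply, Module.Basis.coord_apply, Module.Basis.repr_self, hfb i,
      Fin.sum_univ_two]
    fin_cases i <;> simp
  have hsurj : LinearMap.range (b.coord 1) = ⊤ :=
    LinearMap.range_eq_top.mpr fun a => ⟨a • b 1, by simp [Module.Basis.coord_apply]⟩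
  have hrange : LinearMap.range (f - 1) = Submodule.span ℤ_[p] {c • b 0} := by
    rw [hf1, LinearMap.range_comp_of_range_eq_top _ hsurj, ← LinearMap.span_singleton_eq_range]
  have hne : c • b 0 ≠ 0 := smul_ne_zero hc (b.ne_zero 0)
  have h1 : Module.finrank ℤ_[p] (Submodule.span ℤ_[p] {c • b 0}) = 1 := by
    rw [← (LinearEquiv.toSpanNonzeroSingleton ℤ_[p] T (c • b 0) hne).finrank_eq, Module.finrank_self]
  have h2 : Module.finrank ℤ_[p] T = 2 := by
    rw [Module.finrank_eq_card_basis b, Fintype.card_fin]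
  have hrn := Submodule.finrank_quotient_add_finrank (LinearMap.range (f - 1))
  rw [hrange, h1, h2] at hrn
  rw [hrange]
  omega

/-- **Kato Thm. 13.4, hypothesis (v) for `T_pE`, for EVERY non-CM elliptic curve `E/ℚ` (globally
minimal model) and EVERY prime `p`**: some `σ ∈ Gal(ℚ̄/ℚ)` fixing all `p`-power roots of unity
(`σ ∈ Gal(ℚ̄/ℚ(ζ_{p^∞}))`) has `Coker(ρ_{E,p}(σ) − 1 : T_pE → T_pE)` of `ℤ_p`-rank `1` — verbatim
the hypothesis-(v) binder of `Kato2004.thm13_4_lengthAt_fineSelmerDual_le_of_isEulerSystemClass`.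
Proof: the image of `ρ_{E,p}` contains `Γ(pˢ)` (`WeierstrassCurve.exists_congruenceSubgroup_le_of_not_hasCM`),
hence the unipotent `(1 pˢ; 0 1)`; its determinant is `1 = χ_p(σ)`, so `σ` fixes `μ_{p^∞}`
(`Kato2004.smul_eq_self_of_det_galoisRepTate_eq_one`), and `rank Coker = 1`
(`finrank_quotient_range_sub_one_eq_one`).  Kato: "(v) is not satisfied in the CM case" — and it IS
satisfied otherwise ((12.8.2), Serre's open image).
[cite: Kato2004Asterisque, Thm. 13.4 (v) and the remark after it (p. 226); (12.8.2) (p. 223)]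
[cite: SerreAbelianLadic1968, Ch. IV §2.2 Théorème (IV-11)] -/
theorem exists_finrank_coker_eq_one_of_not_hasCM (W : WeierstrassCurve ℚ) [W.IsElliptic]
    [W.IsGloballyMinimal] (hW : ¬ W.HasCM) (p : ℕ) [Fact p.Prime] :
    ∃ σ : absoluteGaloisGroup ℚ,
      (∀ (n : ℕ) (t : AlgebraicClosure ℚ), t ^ p ^ n = 1 → σ • t = t) ∧
        Module.finrank ℤ_[p]
          ((W.tateModule p) ⧸ LinearMap.range (W.galoisRepTate p σ - 1)) = 1 := by
  classical
  have hp : p.Prime := Fact.out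
  have hp0 : (p : ℚ) ≠ 0 := Nat.cast_ne_zero.mpr hp.ne_zero
  haveI : Module.Free ℤ_[p] (W.tateModule p) := module_free_tateModule_holds W p
  haveI : Module.Finite ℤ_[p] (W.tateModule p) := module_finite_tateModule_holds W p
  let bT : Module.Basis (Fin 2) ℤ_[p] (W.tateModule p) :=
    Module.finBasisOfFinrankEq ℤ_[p] (W.tateModule p) (finrank_tateModule_eq_two_holds W p hp0)
  obtain ⟨s, -, hall⟩ := W.exists_congruenceSubgroup_le_of_not_hasCM hW p bT
  set c : ℤ_[p] := (p : ℤ_[p]) ^ s with hcdef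
  have hc0 : c ≠ 0 := pow_ne_zero _ (Nat.cast_ne_zero.mpr hp.ne_zero)
  -- the unipotent `u = (1 c; 0 1) ∈ Γ(pˢ)`
  let u : GL (Fin 2) ℤ_[p] :=
    ⟨!![1, c; 0, 1], !![1, -c; 0, 1], by simp [Matrix.one_fin_two], by simp [Matrix.one_fin_two]⟩
  have hu : u ∈ GL2.congruenceSubgroup (p := p) s := by
    rw [GL2.mem_congruenceSubgroup_iff]
    intro i j
    fin_cases i <;> fin_cases j <;> simp [u, hcdef]
  obtain ⟨σ, hσ⟩ := hall u hu
  have hσ' : LinearMap.toMatrix bT bT (W.galoisRepTate p σ) = !![1, c; 0, 1] := hσ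
  have hdet : LinearMap.det (W.galoisRepTate p σ : W.tateModule p →ₗ[ℤ_[p]] W.tateModule p) = 1 := by
    rw [← LinearMap.det_toMatrix bT, hσ', Matrix.det_fin_two_of]
    ring
  refine ⟨σ, smul_eq_self_of_det_galoisRepTate_eq_one W p σ hdet, ?_⟩
  exact finrank_quotient_range_sub_one_eq_one bT _ hc0 hσ'

/-- **A `σ`-equivariant isomorphism of Tate modules identifies the cokernels of `ρ(σ) − 1`.**
For Weierstrass curves `X, Y` over a field, a `ℤ_p`-linear `L : T_pX ≃ T_pY` with
`L ∘ ρ_X(σ) = ρ_Y(σ) ∘ L` induces `T_pX/(ρ_X(σ) − 1) ≃ T_pY/(ρ_Y(σ) − 1)`; in particular the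
`ℤ_p`-ranks of Kato's cokernels agree. [cite: Kato2004Asterisque, Thm. 13.4 (v) (p. 226)] -/
theorem finrank_coker_eq_of_tateModule_linearEquiv {K : Type} [Field K] {X Y : WeierstrassCurve K}
    (L : X.tateModule p ≃ₗ[ℤ_[p]] Y.tateModule p) {σ : absoluteGaloisGroup K}
    (hL : ∀ a, L (X.galoisRepTate p σ a) = Y.galoisRepTate p σ (L a)) :
    Module.finrank ℤ_[p] ((X.tateModule p) ⧸ LinearMap.range (X.galoisRepTate p σ - 1)) =
      Module.finrank ℤ_[p] ((Y.tateModule p) ⧸ LinearMap.range (Y.galoisRepTate p σ - 1)) := by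
  have hcomp : (L : X.tateModule p →ₗ[ℤ_[p]] Y.tateModule p).comp (X.galoisRepTate p σ - 1) =
      (Y.galoisRepTate p σ - 1).comp (L : X.tateModule p →ₗ[ℤ_[p]] Y.tateModule p) := by
    ext a
    simp only [LinearMap.comp_apply, LinearMap.sub_apply, Module.End.one_apply, map_sub,
      LinearEquiv.coe_coe, hL]
  have hmap : (LinearMap.range (X.galoisRepTate p σ - 1)).map
      (L : X.tateModule p →ₗ[ℤ_[p]] Y.tateModule p) = LinearMap.range (Y.galoisRepTate p σ - 1) := by
    rw [← LinearMap.range_comp, hcomp, LinearMap.range_comp_of_range_eq_top _ L.range]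
  exact (Submodule.Quotient.equiv _ _ L hmap).finrank_eq

/-- **Hypothesis (v) is invariant under the quadratic twist by `p*`** (`p` odd): if
`C • W.quadraticTwist p* = V` (`p* = (−1)^{⌊p/2⌋} p`) and (v) holds for `T_pV`, it holds for
`T_pW`, with the same `σ`: every `σ` fixing the `p`-power roots of unity fixes `√p* ∈ ℚ(ζ_p)`
(`smul_geomSqrt_primeStar_eq`, Gauss), so the untwisting `(C • W^{(p*)})(ℚ̄) ≃ W(ℚ̄)` is
`σ`-equivariant and induces `T_pV ≃ T_pW` commuting with `ρ(σ)`.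
[cite: Kato2004Asterisque, Thm. 13.4 (v) (p. 226) and (12.5.2) (p. 222)]
[cite: SilvermanAEC2009, X.5 Cor. 5.4 and III.§7] -/
theorem exists_finrank_coker_eq_one_of_smul_eq_quadraticTwist_primeStar (hp2 : p ≠ 2)
    {V W : WeierstrassCurve ℚ} (C : VariableChange ℚ)
    (hWV : C • W.quadraticTwist (((-1 : ℚ) ^ (p / 2)) * p) = V)
    (hv : ∃ σ : absoluteGaloisGroup ℚ,
      (∀ (n : ℕ) (t : AlgebraicClosure ℚ), t ^ p ^ n = 1 → σ • t = t) ∧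
        Module.finrank ℤ_[p] ((V.tateModule p) ⧸ LinearMap.range (V.galoisRepTate p σ - 1)) = 1) :
    ∃ σ : absoluteGaloisGroup ℚ,
      (∀ (n : ℕ) (t : AlgebraicClosure ℚ), t ^ p ^ n = 1 → σ • t = t) ∧
        Module.finrank ℤ_[p] ((W.tateModule p) ⧸ LinearMap.range (W.galoisRepTate p σ - 1)) = 1 := by
  have hp : p.Prime := Fact.out
  obtain ⟨σ, hσ, hrank⟩ := hv
  subst hWV
  set d : ℚ := ((-1 : ℚ) ^ (p / 2)) * p with hd
  have hd0 : d ≠ 0 := mul_ne_zero (pow_ne_zero _ (by norm_num)) (Nat.cast_ne_zero.mpr hp.ne_zero)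
  -- the untwisting `W^{(d)}(ℚ̄) ≃+ W(ℚ̄)`, equivariant on the stabiliser of `√d`
  obtain ⟨f, hf⟩ := exists_addEquiv_geomPoints_quadraticTwist W hd0
  -- the change of variables `W^{(d)}(ℚ̄) ≃+ (C • W^{(d)})(ℚ̄)`, equivariant for all of `Γ_ℚ`
  let e : (W.quadraticTwist d).geomPoints ≃+ (C • W.quadraticTwist d).geomPoints :=
    VariableChange.pointEquivBaseChange (W.quadraticTwist d) C (AlgebraicClosure ℚ)
  have he : ∀ (τ : absoluteGaloisGroup ℚ) (P : (W.quadraticTwist d).geomPoints),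
      e (τ • P) = τ • e P := fun τ P ↦
    VariableChange.pointEquivBaseChange_map_algEquiv (W.quadraticTwist d) C
      (absoluteGaloisGroup.toAlgEquiv ℚ τ) P
  let F : (C • W.quadraticTwist d).geomPoints ≃+ W.geomPoints := e.symm.trans f
  have hfix : σ • geomSqrt d = geomSqrt d := smul_geomSqrt_primeStar_eq hp2 σ hσ
  have hF : ∀ τ ∈ ({σ} : Set (absoluteGaloisGroup ℚ)), ∀ P, F (τ • P) = τ • F P := by
    intro τ hτ P
    rw [Set.mem_singleton_iff] at hτ
    subst hτ
    change f (e.symm (τ • P)) = τ • f (e.symm P)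
    have h1 : e.symm (τ • P) = τ • e.symm P := by
      apply e.injective
      rw [AddEquiv.apply_symm_apply, he, AddEquiv.apply_symm_apply]
    rw [h1, hf τ hfix]
  obtain ⟨L, hL⟩ := exists_tateModule_linearEquiv_of_addEquiv _ _ p _ F hF
  refine ⟨σ, hσ, ?_⟩
  rw [← finrank_coker_eq_of_tateModule_linearEquiv L (hL σ (Set.mem_singleton σ))]
  exact hrank

/-- **Kato Thm. 13.4 (v) for the `p*`-twist partner of a non-CM curve** — the K8 shape
(`BirchSwinnertonDyer`, route `QuadraticBranchSignedControl`): for `p` odd, `V/ℚ` globally minimal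
WITHOUT complex multiplication and `W` with `C • W.quadraticTwist p* = V` (so `W ≅ V ⊗ η`, `η` the
quadratic character of `ℚ(√p*) ⊂ ℚ(ζ_p)`), some `σ ∈ Gal(ℚ̄/ℚ(ζ_{p^∞}))` has
`rank_{ℤ_p} Coker(ρ_{W,p}(σ) − 1) = 1`.  Unconditional (open image for `V`, twist transport).
[cite: Kato2004Asterisque, Thm. 13.4 (v) and the remark after it (p. 226)]
[cite: SerreAbelianLadic1968, Ch. IV §2.2 Théorème (IV-11)] -/
theorem exists_finrank_coker_eq_one_twist_of_not_hasCM (hp2 : p ≠ 2) {V W : WeierstrassCurve ℚ}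
    [V.IsElliptic] [V.IsGloballyMinimal] (hV : ¬ V.HasCM) (C : VariableChange ℚ)
    (hWV : C • W.quadraticTwist (((-1 : ℚ) ^ (p / 2)) * p) = V) :
    ∃ σ : absoluteGaloisGroup ℚ,
      (∀ (n : ℕ) (t : AlgebraicClosure ℚ), t ^ p ^ n = 1 → σ • t = t) ∧
        Module.finrank ℤ_[p] ((W.tateModule p) ⧸ LinearMap.range (W.galoisRepTate p σ - 1)) = 1 :=
  exists_finrank_coker_eq_one_of_smul_eq_quadraticTwist_primeStar hp2 C hWV
    (exists_finrank_coker_eq_one_of_not_hasCM V hV p)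

/-- **Kato Thm. 13.4 (v) for the `p*`-twist `V^{(p*)}` of a globally minimal non-CM `V/ℚ`** (`p`
odd) — the form `W := V.quadraticTwist p*` used on the K8 row theorems.
[cite: Kato2004Asterisque, Thm. 13.4 (v) and the remark after it (p. 226)] -/
theorem exists_finrank_coker_eq_one_quadraticTwist_primeStar_of_not_hasCM (hp2 : p ≠ 2)
    (V : WeierstrassCurve ℚ) [V.IsElliptic] [V.IsGloballyMinimal] (hV : ¬ V.HasCM) :
    ∃ σ : absoluteGaloisGroup ℚ,
      (∀ (n : ℕ) (t : AlgebraicClosure ℚ), t ^ p ^ n = 1 → σ • t = t) ∧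
        Module.finrank ℤ_[p]
          (((V.quadraticTwist (((-1 : ℚ) ^ (p / 2)) * p)).tateModule p) ⧸
            LinearMap.range
              ((V.quadraticTwist (((-1 : ℚ) ^ (p / 2)) * p)).galoisRepTate p σ - 1)) = 1 := by
  have hp : p.Prime := Fact.out
  have hc : (((-1 : ℚ) ^ (p / 2)) * p) ≠ 0 :=
    mul_ne_zero (pow_ne_zero _ (by norm_num)) (Nat.cast_ne_zero.mpr hp.ne_zero)
  -- `V` is a model of the `p*`-twist of its own `p*`-twist: `(V^{(c)})^{(c)} = V^{(c²)} ≅ V`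
  obtain ⟨C₀, hC₀⟩ := V.exists_variableChange_smul_eq_quadraticTwist_sq
    (θ := ((-1 : ℚ) ^ (p / 2)) * p) hc
  have hC : C₀⁻¹ • ((V.quadraticTwist (((-1 : ℚ) ^ (p / 2)) * p)).quadraticTwist
      (((-1 : ℚ) ^ (p / 2)) * p)) = V := by
    rw [quadraticTwist_quadraticTwist, ← sq, ← hC₀, inv_smul_smul]
  exact exists_finrank_coker_eq_one_twist_of_not_hasCM hp2 hV C₀⁻¹ hC

/-- **Kato Thm. 13.4, hypothesis (v) for `T_pE`, for EVERY non-CM elliptic curve `E/ℚ` — ANY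
Weierstrass model — and EVERY prime `p`.**  Reduction to a global minimal model `C • E`
(`hasGlobalMinimalModel_rat_holds`, Silverman VIII.8.3; no CM is preserved,
`HasCM.of_variableChange_baseChange`), where `exists_finrank_coker_eq_one_of_not_hasCM` applies, and
transport of the cokernel of `ρ(σ) − 1` along the `Γ_ℚ`-equivariant isomorphism `T_pE ≃ T_p(C • E)`
(`VariableChange.pointEquivBaseChange`, `exists_tateModule_linearEquiv_of_addEquiv`,
`finrank_coker_eq_of_tateModule_linearEquiv`).
[cite: Kato2004Asterisque, Thm. 13.4 (v) and the remark after it (p. 226)]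
[cite: SerreAbelianLadic1968, Ch. IV §2.2 Théorème (IV-11)] [cite: SilvermanAEC2009, VIII.8 Cor. 8.3] -/
theorem exists_finrank_coker_eq_one_of_not_hasCM_of_isElliptic (W : WeierstrassCurve ℚ) [W.IsElliptic]
    (hW : ¬ W.HasCM) (p : ℕ) [Fact p.Prime] :
    ∃ σ : absoluteGaloisGroup ℚ,
      (∀ (n : ℕ) (t : AlgebraicClosure ℚ), t ^ p ^ n = 1 → σ • t = t) ∧
        Module.finrank ℤ_[p]
          ((W.tateModule p) ⧸ LinearMap.range (W.galoisRepTate p σ - 1)) = 1 := by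
  -- a global minimal model `C • W`, still without complex multiplication
  obtain ⟨C, hC⟩ := hasGlobalMinimalModel_rat_holds W
  haveI := hC
  have hCM' : ¬ (C • W).HasCM := fun h ↦ hW
    (HasCM.of_variableChange_baseChange (W₁ := W) (W₂ := C • W)
      (C.map (algebraMap ℚ (AlgebraicClosure ℚ))) (map_variableChange W C _) h)
  obtain ⟨σ, hσ, hrank⟩ := exists_finrank_coker_eq_one_of_not_hasCM (C • W) hCM' p
  -- the `Γ_ℚ`-equivariant isomorphism `E(ℚ̄) ≃ (C • E)(ℚ̄)` and the induced `T_pE ≃ T_p(C • E)`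
  let e : W.geomPoints ≃+ (C • W).geomPoints :=
    VariableChange.pointEquivBaseChange W C (AlgebraicClosure ℚ)
  have he : ∀ τ ∈ (Set.univ : Set (absoluteGaloisGroup ℚ)), ∀ P, e (τ • P) = τ • e P :=
    fun τ _ P ↦ VariableChange.pointEquivBaseChange_map_algEquiv W C
      (absoluteGaloisGroup.toAlgEquiv ℚ τ) P
  obtain ⟨L, hL⟩ := exists_tateModule_linearEquiv_of_addEquiv _ _ p _ e he
  refine ⟨σ, hσ, ?_⟩
  rw [finrank_coker_eq_of_tateModule_linearEquiv L (hL σ (Set.mem_univ σ))]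
  exact hrank

end Literature.NumberTheory.EllipticCurves.Kato2004

end
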